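import Mathlib
import Summits.Ventures.HodgeRepro2.Tier7.Target

/-!
# Tier7/Line1/L2Orth — the `L²` pairing on `H^{1,0} ∧ H^{1,0}` and its orthogonal complements (t7-L1-p5)

Part 1 of 2 of the finite-dimensional converse for LINE 1 (LEMMAS.md §3, p5); part 2 is `Line1/FDConverse.lean`
(orthogonal projection as an equivariant linear map + the theorem `exists_commonIrred_of_L2_ne_zero`).

INGREDIENTS, all fields of the frozen `SurfaceShadow` (Target.lean 6e511b88…): the Hecke translates act by
ℂ-algebra automorphisms (`act_add`, `act_mul`, `act_smul`, `act_H10`), `bar` is an antilinear ring involution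
commuting with them (`bar_add`, `bar_smul`, `bar_mul`, `bar_bar`, `bar_act`), `∫_X` is ℂ-linear, real and
Hecke-invariant (`intX_act`, `intX_bar`), even classes commute (`comm_H20`), Hodge–Riemann (`hr_pos`), and
(H9) `H20_semisimple`. (H10) `H20_multone` is NOT used.

WHAT IS PROVED.
* `L2_act`: `⟨g•a, g•b⟩ = ⟨a, b⟩` (Hecke invariance of the `L²` pairing);
* `L2_conj`: `conj ⟨a, b⟩ = ⟨b, a⟩` on `H20 := H10 * H10` (Hermitian symmetry — a THEOREM of the fields, no extra
  hypothesis); `eq_zero_of_L2_self_eq_zero` (positivity);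
* `orth S U` = the `L²`-orthogonal complement of `U` inside `H20`: Hecke-stable for Hecke-stable `U`
  (`orth_heckeStable`), `U ⊓ orth U = ⊥` for `U ≤ H20` (`inf_orth_eq_bot`, Hodge–Riemann), uniqueness of the
  `U`-component (`decomp_unique`), and — the ONLY place finite dimension enters — `H20 = U ⊕ orth U`
  (`exists_decomp`, via Mathlib's orthogonal projection for the inner product `⟪x, y⟫ := ⟨y, x⟩_{L²}` on `H20`,
  `l2Core`);
* `le_iSup_irred` / `exists_irred_not_le`: every Hecke-stable `U ≤ H20` is the sum of the Hecke-irreducible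
  subspaces it contains ((H9) only — no finite dimension).

§8(d): uses an L-value-free non-vanishing device: NO (pure linear algebra over the frozen fields; nothing
here is about the step itself). Author: t7-L1-p5 (prover-pub-hodge-repro2-t7-L1-p5-g0-0).
-/

namespace Summit.Ventures.HodgeRepro2.Tier7.Line1.FD

open Summit.Ventures.HodgeRepro2.Tier7

noncomputable section

variable {HX : Type} [Ring HX] [Algebra ℂ HX] {G : Type} [Group G] [MulAction G HX]
  (S : SurfaceShadow HX G)

/-! ## 1. Elementary consequences of the fields: the action, `bar`, and the `L²` pairing -/

/-- a Hecke translate fixes `0` (from `act_add`) -/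
theorem act_zero (S : SurfaceShadow HX G) (g : G) : g • (0 : HX) = 0 := by
  have h0 := S.act_add g 0 0
  rw [add_zero] at h0
  exact add_left_cancel (h0.symm.trans (add_zero _).symm)

/-- a Hecke translate is additive on differences -/
theorem act_sub (S : SurfaceShadow HX G) (g : G) (a b : HX) : g • (a - b) = g • a - g • b := by
  have h := S.act_add g (a - b) b
  rw [sub_add_cancel] at h
  exact eq_sub_of_add_eq h.symm

/-- `bar 0 = 0` (from `bar_add`) -/
theorem bar_zero : S.bar (0 : HX) = 0 := by
  have h0 := S.bar_add 0 0
  rw [add_zero] at h0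
  exact add_left_cancel (h0.symm.trans (add_zero _).symm)

/-- the `L²` pairing is additive in the first variable -/
theorem L2_add_left (a b c : HX) : S.L2 (a + b) c = S.L2 a c + S.L2 b c := by
  simp [SurfaceShadow.L2, add_mul, map_add]

/-- the `L²` pairing is ℂ-linear in the first variable -/
theorem L2_smul_left (z : ℂ) (a c : HX) : S.L2 (z • a) c = z * S.L2 a c := by
  simp [SurfaceShadow.L2, Algebra.smul_mul_assoc, map_smul]

/-- `⟨0, c⟩ = 0` -/
theorem L2_zero_left (c : HX) : S.L2 0 c = 0 := by
  simp [SurfaceShadow.L2]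

/-- the `L²` pairing is additive in the second variable -/
theorem L2_add_right (a b c : HX) : S.L2 a (b + c) = S.L2 a b + S.L2 a c := by
  simp [SurfaceShadow.L2, S.bar_add, mul_add, map_add]

/-- the `L²` pairing is conjugate-linear in the second variable -/
theorem L2_smul_right (z : ℂ) (a b : HX) : S.L2 a (z • b) = (starRingEnd ℂ) z * S.L2 a b := by
  simp [SurfaceShadow.L2, S.bar_smul, Algebra.mul_smul_comm, map_smul]

/-- `⟨a, 0⟩ = 0` -/
theorem L2_zero_right (a : HX) : S.L2 a 0 = 0 := by
  simp [SurfaceShadow.L2, bar_zero]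

/-- `⟨a - b, c⟩ = ⟨a, c⟩ - ⟨b, c⟩` -/
theorem L2_sub_left (a b c : HX) : S.L2 (a - b) c = S.L2 a c - S.L2 b c := by
  simp [SurfaceShadow.L2, sub_mul, map_sub]

/-- HECKE INVARIANCE of the `L²` pairing: `⟨g • a, g • b⟩ = ⟨a, b⟩` (`act_mul`, `bar_act`, `intX_act`). -/
theorem L2_act (g : G) (a b : HX) : S.L2 (g • a) (g • b) = S.L2 a b := by
  unfold SurfaceShadow.L2
  rw [S.bar_act, ← S.act_mul, S.intX_act]

/-- HERMITIAN SYMMETRY of the `L²` pairing on holomorphic 2-forms: `conj ⟨a, b⟩ = ⟨b, a⟩` for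
`a, b ∈ H^{1,0} ∧ H^{1,0}` (`intX_bar`, `bar_mul`, `bar_bar`, `comm_H20`) — a theorem of the frozen fields. -/
theorem L2_conj (a b : HX) (ha : a ∈ S.H10 * S.H10) (hb : b ∈ S.H10 * S.H10) :
    (starRingEnd ℂ) (S.L2 a b) = S.L2 b a := by
  unfold SurfaceShadow.L2
  rw [← S.intX_bar, S.bar_mul, S.bar_bar, ← S.comm_H20 b hb a ha]

/-- `⟨a, b⟩ ≠ 0 ↔ ⟨b, a⟩ ≠ 0` on holomorphic 2-forms -/
theorem L2_ne_zero_comm (a b : HX) (ha : a ∈ S.H10 * S.H10) (hb : b ∈ S.H10 * S.H10) :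
    S.L2 a b ≠ 0 ↔ S.L2 b a ≠ 0 := by
  rw [← L2_conj S a b ha hb]
  exact (map_ne_zero _).symm

/-- POSITIVITY: `⟨a, a⟩ = 0` forces `a = 0` on holomorphic 2-forms (Hodge–Riemann, `hr_pos`). -/
theorem eq_zero_of_L2_self_eq_zero (a : HX) (ha : a ∈ S.H10 * S.H10) (h : S.L2 a a = 0) : a = 0 := by
  by_contra hne
  have hpos := S.hr_pos a ha hne
  have h0 : S.intX (a * S.bar a) = 0 := h
  rw [h0] at hpos
  simp at hpos

/-- `H^{1,0} ∧ H^{1,0}` is Hecke-stable (`act_mul`, `act_H10`, `act_add`). -/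
theorem H20_heckeStable : HeckeStable G (S.H10 * S.H10) := by
  intro g a ha
  refine Submodule.mul_induction_on ha (fun m hm n hn => ?_) (fun x y hx hy => ?_)
  · rw [S.act_mul]
    exact Submodule.mul_mem_mul (S.act_H10 g m hm) (S.act_H10 g n hn)
  · rw [S.act_add]
    exact Submodule.add_mem _ hx hy

/-- a supremum of Hecke-stable subspaces is Hecke-stable -/
theorem heckeStable_iSup (S : SurfaceShadow HX G) {ι : Type} (W : ι → Submodule ℂ HX)
    (hW : ∀ i, HeckeStable G (W i)) :
    HeckeStable G (⨆ i, W i) := by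
  intro g a ha
  refine Submodule.iSup_induction W (motive := fun x => g • x ∈ ⨆ i, W i) ha
    (fun i x hx => Submodule.mem_iSup_of_mem i (hW i g x hx)) ?_ (fun x y hx hy => ?_)
  · rw [act_zero S]
    exact Submodule.zero_mem _
  · rw [S.act_add]
    exact Submodule.add_mem _ hx hy

/-! ## 2. Annihilators and the orthogonal complement inside `H^{1,0} ∧ H^{1,0}` -/

/-- the left annihilator `{a | ∀ b ∈ T, ⟨a, b⟩ = 0}` (a ℂ-subspace: `L2` is linear in `a`) -/
def annL (T : Submodule ℂ HX) : Submodule ℂ HX where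
  carrier := {a | ∀ b ∈ T, S.L2 a b = 0}
  zero_mem' := by
    simp only [Set.mem_setOf_eq]
    exact fun b _ => L2_zero_left S b
  add_mem' := by
    intro x y hx hy
    simp only [Set.mem_setOf_eq] at hx hy ⊢
    intro b hb
    rw [L2_add_left, hx b hb, hy b hb, add_zero]
  smul_mem' := by
    intro c x hx
    simp only [Set.mem_setOf_eq] at hx ⊢
    intro b hb
    rw [L2_smul_left, hx b hb, mul_zero]

/-- the right annihilator `{b | ∀ a ∈ T, ⟨a, b⟩ = 0}` (a ℂ-subspace: `L2` is conjugate-linear in `b`) -/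
def annR (T : Submodule ℂ HX) : Submodule ℂ HX where
  carrier := {b | ∀ a ∈ T, S.L2 a b = 0}
  zero_mem' := by
    simp only [Set.mem_setOf_eq]
    exact fun a _ => L2_zero_right S a
  add_mem' := by
    intro x y hx hy
    simp only [Set.mem_setOf_eq] at hx hy ⊢
    intro a ha
    rw [L2_add_right, hx a ha, hy a ha, add_zero]
  smul_mem' := by
    intro c x hx
    simp only [Set.mem_setOf_eq] at hx ⊢
    intro a ha
    rw [L2_smul_right, hx a ha, mul_zero]

/-- membership in the left annihilator -/
theorem mem_annL (T : Submodule ℂ HX) (a : HX) : a ∈ annL S T ↔ ∀ b ∈ T, S.L2 a b = 0 := Iff.rfl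

/-- membership in the right annihilator -/
theorem mem_annR (T : Submodule ℂ HX) (b : HX) : b ∈ annR S T ↔ ∀ a ∈ T, S.L2 a b = 0 := Iff.rfl

/-- the `L²`-ORTHOGONAL COMPLEMENT of `U` inside `H^{1,0} ∧ H^{1,0}`:
`orth U = {x ∈ H^{1,0} ∧ H^{1,0} | ∀ u ∈ U, ⟨x, u⟩ = 0}` -/
def orth (U : Submodule ℂ HX) : Submodule ℂ HX := (S.H10 * S.H10) ⊓ annL S U

/-- membership in the orthogonal complement -/
theorem mem_orth (U : Submodule ℂ HX) (x : HX) :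
    x ∈ orth S U ↔ x ∈ S.H10 * S.H10 ∧ ∀ u ∈ U, S.L2 x u = 0 := Iff.rfl

/-- `orth U ⊆ H^{1,0} ∧ H^{1,0}` -/
theorem orth_le (U : Submodule ℂ HX) : orth S U ≤ S.H10 * S.H10 := inf_le_left

/-- the orthogonal complement of a Hecke-stable subspace is Hecke-stable (Hecke invariance of `L2`) -/
theorem orth_heckeStable (U : Submodule ℂ HX) (hU : HeckeStable G U) : HeckeStable G (orth S U) := by
  intro g x hx
  rw [mem_orth] at hx ⊢
  refine ⟨H20_heckeStable S g x hx.1, fun u hu => ?_⟩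
  have h1 : S.L2 (g • x) u = S.L2 (g • x) (g • (g⁻¹ • u)) := by rw [smul_inv_smul]
  rw [h1, L2_act]
  exact hx.2 _ (hU g⁻¹ u hu)

/-- `U ⊓ orth U = ⊥` for `U ⊆ H^{1,0} ∧ H^{1,0}` (Hodge–Riemann) -/
theorem inf_orth_eq_bot (U : Submodule ℂ HX) (hU : U ≤ S.H10 * S.H10) : U ⊓ orth S U = ⊥ := by
  rw [eq_bot_iff]
  intro x hx
  rw [Submodule.mem_inf, mem_orth] at hx
  rw [Submodule.mem_bot]
  exact eq_zero_of_L2_self_eq_zero S x (hU hx.1) (hx.2.2 x hx.1)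

/-- uniqueness of the `U`-component: if `u + v = u' + v'` with `u, u' ∈ U ⊆ H^{1,0} ∧ H^{1,0}` and
`v, v' ∈ orth U`, then `u = u'` -/
theorem decomp_unique (U : Submodule ℂ HX) (hU : U ≤ S.H10 * S.H10) {u v u' v' : HX}
    (hu : u ∈ U) (hv : v ∈ orth S U) (hu' : u' ∈ U) (hv' : v' ∈ orth S U) (h : u + v = u' + v') :
    u = u' := by
  have h1 : u - u' = v' - v := by
    rw [sub_eq_sub_iff_add_eq_add, h, add_comm]
  have h2 : u - u' ∈ U ⊓ orth S U := by
    refine ⟨Submodule.sub_mem _ hu hu', ?_⟩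
    rw [h1]
    exact Submodule.sub_mem _ hv' hv
  rw [inf_orth_eq_bot S U hU, Submodule.mem_bot] at h2
  exact sub_eq_zero.mp h2

/-! ## 3. Finite dimension: `H^{1,0} ∧ H^{1,0} = U ⊕ orth U` (via Mathlib's orthogonal projection) -/

/-- The `L²` pairing as an inner product on `H^{1,0} ∧ H^{1,0}`, in Mathlib's convention (conjugate-linear
in the FIRST variable): `⟪x, y⟫ := ⟨y, x⟩_{L²} = ∫_X y ∧ x̄`. Positive definite by Hodge–Riemann. -/
abbrev l2Core : InnerProductSpace.Core ℂ ↥(S.H10 * S.H10) where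
  inner x y := S.L2 (y : HX) (x : HX)
  conj_inner_symm x y := L2_conj S (x : HX) (y : HX) x.2 y.2
  re_inner_nonneg x := by
    show 0 ≤ RCLike.re (S.L2 (x : HX) (x : HX))
    rw [RCLike.re_to_complex]
    by_cases hx : (x : HX) = 0
    · rw [hx, L2_zero_left]
      simp
    · exact le_of_lt (S.hr_pos (x : HX) x.2 hx)
  add_left x y z := by
    show S.L2 (z : HX) ((x : HX) + (y : HX)) = S.L2 (z : HX) (x : HX) + S.L2 (z : HX) (y : HX)
    exact L2_add_right S _ _ _
  smul_left x y r := by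
    show S.L2 (y : HX) (r • (x : HX)) = (starRingEnd ℂ) r * S.L2 (y : HX) (x : HX)
    exact L2_smul_right S _ _ _
  definite x hx := by
    have : (x : HX) = 0 := eq_zero_of_L2_self_eq_zero S (x : HX) x.2 hx
    exact Subtype.ext this

/-- THE ONLY USE OF FINITE DIMENSION: every `x ∈ H^{1,0} ∧ H^{1,0}` decomposes as `u + (x - u)` with `u ∈ U`
and `x - u ∈ orth U` (orthogonal projection in the finite-dimensional inner product space `l2Core`). -/
theorem exists_decomp [FiniteDimensional ℂ ↥(S.H10 * S.H10)] (U : Submodule ℂ HX)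
    (hU : U ≤ S.H10 * S.H10) (x : HX) (hx : x ∈ S.H10 * S.H10) :
    ∃ u, u ∈ U ∧ x - u ∈ orth S U := by
  letI : NormedAddCommGroup ↥(S.H10 * S.H10) :=
    @InnerProductSpace.Core.toNormedAddCommGroup ℂ ↥(S.H10 * S.H10) _ _ _ (l2Core S)
  letI : InnerProductSpace ℂ ↥(S.H10 * S.H10) := InnerProductSpace.ofCore _
  let K : Submodule ℂ ↥(S.H10 * S.H10) := U.comap (S.H10 * S.H10).subtype
  haveI : CompleteSpace K := FiniteDimensional.complete ℂ K
  obtain ⟨y, hy, hz⟩ := Submodule.HasOrthogonalProjection.exists_orthogonal (K := K) ⟨x, hx⟩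
  refine ⟨(y : HX), hy, ?_⟩
  rw [mem_orth]
  refine ⟨Submodule.sub_mem _ hx (hU hy), fun u hu => ?_⟩
  have h1 := (Submodule.mem_orthogonal K _).mp hz ⟨u, hU hu⟩ hu
  change S.L2 (((⟨x, hx⟩ : ↥(S.H10 * S.H10)) - y : ↥(S.H10 * S.H10)) : HX) u = 0 at h1
  rwa [Submodule.coe_sub] at h1

/-! ## 4. (H9): a Hecke-stable subspace of `H^{1,0} ∧ H^{1,0}` is the sum of its irreducible subspaces -/

/-- every Hecke-stable `U ⊆ H^{1,0} ∧ H^{1,0}` is contained in (hence equal to) the sum of the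
Hecke-irreducible subspaces it contains (`H20_semisimple`: complements + existence of irreducibles) -/
theorem le_iSup_irred (U : Submodule ℂ HX) (hU : U ≤ S.H10 * S.H10) (hUs : HeckeStable G U) :
    U ≤ iSup (fun W : {W : Submodule ℂ HX // W ≤ U ∧ HeckeIrred G W} => (W : Submodule ℂ HX)) := by
  set V : Submodule ℂ HX :=
    iSup (fun W : {W : Submodule ℂ HX // W ≤ U ∧ HeckeIrred G W} => (W : Submodule ℂ HX))
  have hVU : V ≤ U := iSup_le fun W => W.2.1
  have hVs : HeckeStable G V := heckeStable_iSup S _ (fun W => W.2.2.2.1)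
  obtain ⟨⟨V', _, hV's, hinf, hsup⟩, _⟩ := S.H20_semisimple V (hVU.trans hU) hVs
  have hV''s : HeckeStable G (V' ⊓ U) := fun g a ha => ⟨hV's g a ha.1, hUs g a ha.2⟩
  have hbot : V' ⊓ U = ⊥ := by
    by_contra hne
    obtain ⟨W, hWle, hWirr⟩ :=
      (S.H20_semisimple (V' ⊓ U) (inf_le_right.trans hU) hV''s).2 hne
    have hWV : W ≤ V :=
      le_iSup (fun W : {W : Submodule ℂ HX // W ≤ U ∧ HeckeIrred G W} => (W : Submodule ℂ HX))
        ⟨W, hWle.trans inf_le_right, hWirr⟩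
    have hWV' : W ≤ V' := hWle.trans inf_le_left
    have hWbot : W ≤ ⊥ := by
      rw [← hinf]
      exact le_inf hWV hWV'
    exact hWirr.1 (le_bot_iff.mp hWbot)
  intro b hb
  have hbH : b ∈ V ⊔ V' := by
    rw [hsup]
    exact hU hb
  obtain ⟨v, hv, v', hv', rfl⟩ := Submodule.mem_sup.mp hbH
  have hv'U : v' ∈ U := by
    have := Submodule.sub_mem _ hb (hVU hv)
    rwa [add_sub_cancel_left] at this
  have hmem : v' ∈ V' ⊓ U := ⟨hv', hv'U⟩
  rw [hbot, Submodule.mem_bot] at hmem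
  rw [hmem, add_zero]
  exact hv

/-- if a Hecke-stable `U ⊆ H^{1,0} ∧ H^{1,0}` is not contained in a subspace `Z`, then some Hecke-irreducible
`W ≤ U` is not contained in `Z` -/
theorem exists_irred_not_le (U : Submodule ℂ HX) (hU : U ≤ S.H10 * S.H10) (hUs : HeckeStable G U)
    (Z : Submodule ℂ HX) (h : ¬ U ≤ Z) :
    ∃ W : Submodule ℂ HX, W ≤ U ∧ HeckeIrred G W ∧ ¬ W ≤ Z := by
  by_contra hcon
  apply h
  refine (le_iSup_irred S U hU hUs).trans (iSup_le fun W => ?_)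
  by_contra hWZ
  exact hcon ⟨W, W.2.1, W.2.2, hWZ⟩

end

end Summit.Ventures.HodgeRepro2.Tier7.Line1.FD
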